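import Mathlib
import Summits.CriticalPhenomena.CardyFormulaZ2.Theorems.CardyMagicRigidityNestingRigidityUVTiltTransfer
import Literature.Probability.Percolation.BondPercolationBlockIndependence
import HarnessLib

/-!
# Crux `NestingRigidity`, line `positive-cone-weight-doubling`: MUTUAL independence of the
# statistics of the loops INSIDE pairwise separated regions, both lattices (chessboard input of [A])

Crux `Summit.CriticalPhenomena.CardyFormulaZ2.Theses.CardyMagicRigidity.NestingRigidity`
(stmt-CriticalPhenomena-4835), line `positive-cone-weight-doubling`, registered helper [A]
`uvExpMoments_latticeEnsembles`.  The one-scale step of the multi-scale bound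
(`expMoment_centredSum_le_latticeEnsembles`, …UVExpMomentsAssembly) needs the cell statistics of one
chessboard class to be MUTUALLY independent (`iIndepFun`).  A cell statistic of scale `ρ` reads the
loops of diameter `< ρ` anchored in the cell, all of whose traces lie INSIDE the `ρ`-neighbourhood
`A` of the cell; cells of one class have pairwise separated neighbourhoods.  This file proves the
exact lattice fact behind this (no cited fact, no definition), extending the two-observable lemmas of
…TowerIndependence / …UVTiltTransfer to families:

* §1 abstract site percolation: observables determined by pairwise disjoint site sets are mutually
  independent (`iIndep_biSup_of_pairwise_disjoint` of the Literature block-independence file + the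
  coordinate independence `iIndepFun_mem_sitePercolation`); the bond version is the Literature lemma
  `bondPercolation_iIndepFun_of_disjoint`;
* §2 cylinder property of INNER loop families: the family `{u ∈ X_δ(ω) | trace u ⊆ A}` reads only
  the edges with medial point in `A` (bond-`ℤ²`) / the sites within `δ` of `A` (site-`𝕋`) — the
  far-family lemmas of …UVTiltTransfer at the complement `Aᶜ`;
* §3 MUTUAL INDEPENDENCE (registered anchor `iIndepFun_finsum_innerLoops_latticeEnsembles`): for
  `E ∈ latticeEnsembles`, mesh `δ ≥ 0` and regions `A_k` pairwise more than `2δ` apart, every family of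
  statistics `Σ_{u ∈ X_δ, trace u ⊆ A_k, Q_k u} g_k u` (in particular loop counts, `g = 1`) is
  `iIndepFun` under `E.P`; general functionals of the inner families (`iIndepFun_innerLoops_zEns/tEns`).
-/

noncomputable section

open MeasureTheory ProbabilityTheory Set Filter Metric
open scoped Real Topology BigOperators

namespace Summit.CriticalPhenomena.CardyFormulaZ2.Cruxes.NestingRigidity.PositiveConeWeightDoubling

open Literature.Probability.RandomPlanarGeometry Literature.Probability.Percolation
  Literature.Probability.LatticeModels
open Summit.CriticalPhenomena.CardyFormulaZ2.Cruxes.NestingRigidity.RingCloudTomography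
open Summit.CriticalPhenomena.CardyFormulaZ2.Cruxes.NestingRigidity.MarkovCascadeOneGeneration
  (iIndepFun_mem_sitePercolation comap_le_of_determined)

namespace UVExpMoments

/-! ## §1 Site percolation: observables of pairwise disjoint site sets are mutually independent -/

/-- **Observables determined by pairwise disjoint sets of sites are mutually independent** under
`sitePercolation V p` (the family version of `indepFun_of_determined`): group the independent
coordinates `1_{v ∈ ω}` by the disjoint index sets (`iIndep_biSup_of_pairwise_disjoint`) and factor
each observable through `ω ↦ ω ∩ S_k` (`comap_le_of_determined`). -/
theorem iIndepFun_of_determined_site {V : Type*} (p : unitInterval) {κ : Type*} (S : κ → Set V)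
    (hS : Pairwise fun k l ↦ Disjoint (S k) (S l)) {β : κ → Type*} [∀ k, MeasurableSpace (β k)]
    {f : ∀ k, SiteConfig V → β k} (hfm : ∀ k, Measurable (f k))
    (hdet : ∀ k ω, f k (ω ∩ S k) = f k ω) : iIndepFun f (sitePercolation V p) := by
  have hind := (iIndepFun_mem_sitePercolation V p).iIndep
  have hle : ∀ v : V, MeasurableSpace.comap (fun ω : SiteConfig V ↦ v ∈ ω) inferInstance ≤
      (inferInstance : MeasurableSpace (SiteConfig V)) := fun v ↦ (measurable_set_mem v).comap_le
  rw [iIndepFun_iff_iIndep]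
  exact iIndep_of_iIndep_of_le (iIndep_biSup_of_pairwise_disjoint hle hind S hS)
    fun k ↦ comap_le_of_determined (hfm k) (hdet k)

/-! ## §2 Cylinder property of the inner loop families -/

/-- A loop lies inside `A` iff its trace misses `Aᶜ`. -/
theorem sep_subset_eq_sep_disjoint_compl (L : Set (UnbasedLoop ℂ)) (A : Set ℂ) :
    {u ∈ L | u.range ⊆ A} = {u ∈ L | Disjoint u.range Aᶜ} := by
  ext u
  simp only [mem_setOf_eq, Set.disjoint_compl_right_iff_subset]

/-- **Bond-`ℤ²`**: closing every edge off `M`, `M` containing all edges with medial point in `A`,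
does not change the family of loops of `X_δ(ω)` with trace inside `A`. -/
theorem innerFamily_zEns_inter (δ : ℝ) (ω M : BondConfig (Site 2)) (A : Set ℂ)
    (hM : ∀ e : MedialVertex, medialPoint δ e ∈ A → e ∈ M) :
    {u ∈ (zEns.X δ (ω ∩ M : BondConfig (Site 2))).loops | u.range ⊆ A} =
      {u ∈ (zEns.X δ ω).loops | u.range ⊆ A} := by
  rw [sep_subset_eq_sep_disjoint_compl, sep_subset_eq_sep_disjoint_compl]
  exact TiltTransfer.farFamily_zEns_inter δ ω M Aᶜ fun e he ↦ hM e (not_notMem.1 he)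

/-- **Site-`𝕋`** (mesh `δ ≥ 0`): closing every site off `S`, `S` containing all sites drawn within
`δ` of a point of `A`, does not change the family of loops of `X_δ(ω)` with trace inside `A`. -/
theorem innerFamily_tEns_inter {δ : ℝ} (hδ : 0 ≤ δ) (ω S : SiteConfig (Site 2)) (A : Set ℂ)
    (hS : ∀ (s : Site 2) (p : ℂ), p ∈ A → dist p (triMeshPoint δ s) ≤ δ → s ∈ S) :
    {u ∈ (tEns.X δ (ω ∩ S : SiteConfig (Site 2))).loops | u.range ⊆ A} =
      {u ∈ (tEns.X δ ω).loops | u.range ⊆ A} := by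
  rw [sep_subset_eq_sep_disjoint_compl, sep_subset_eq_sep_disjoint_compl]
  exact TiltTransfer.farFamily_tEns_inter hδ ω S Aᶜ fun s p hp hps ↦ hS s p (not_notMem.1 hp) hps

/-! ## §3 Mutual independence of functionals of the inner families of separated regions -/

/-- **Bond-`ℤ²`, general functionals.**  For pairwise DISJOINT regions `A_k` and measurable
functionals `Φ_k` of the inner families `{u ∈ X_δ(ω) | trace u ⊆ A_k}`, the observables
`ω ↦ Φ_k(inner family of A_k)` are mutually independent under `zEns.P` (they read the pairwise disjoint
edge sets `{e | medialPoint δ e ∈ A_k}` of the product measure). -/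
theorem iIndepFun_innerLoops_zEns (δ : ℝ) {κ : Type*} (A : κ → Set ℂ)
    (hA : Pairwise fun k l ↦ Disjoint (A k) (A l)) {β : κ → Type*} [∀ k, MeasurableSpace (β k)]
    (Φ : ∀ k, Set (UnbasedLoop ℂ) → β k)
    (hΦ : ∀ k, Measurable fun ω : zEns.Ω ↦ Φ k {u ∈ (zEns.X δ ω).loops | u.range ⊆ A k}) :
    iIndepFun (fun k (ω : zEns.Ω) ↦ Φ k {u ∈ (zEns.X δ ω).loops | u.range ⊆ A k}) zEns.P := by
  change iIndepFun (fun k (ω : BondConfig (Site 2)) ↦ Φ k {u ∈ (zEns.X δ ω).loops | u.range ⊆ A k})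
    (bondPercolation (zdGraph 2) half)
  refine bondPercolation_iIndepFun_of_disjoint (zdGraph 2) half
    (fun k ↦ {e : MedialVertex | medialPoint δ e ∈ A k})
    (fun k l hkl ↦ Set.disjoint_left.2 fun e hek hel ↦ Set.disjoint_left.1 (hA hkl) hek hel) _
    fun k ↦ measurable_edgeSigma_of_forall_inter (hΦ k) _ fun ω ↦ ?_
  exact congrArg (Φ k)
    (innerFamily_zEns_inter δ ω {e : MedialVertex | medialPoint δ e ∈ A k} (A k) fun e he ↦ he).symm

/-- **Site-`𝕋`, general functionals** (mesh `δ ≥ 0`).  For regions `A_k` pairwise MORE THAN `2δ`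
APART and measurable functionals `Φ_k` of the inner families, the observables
`ω ↦ Φ_k(inner family of A_k)` are mutually independent under `tEns.P` (they read the pairwise
disjoint site sets `{s | dist(A_k, triMeshPoint δ s) ≤ δ}`). -/
theorem iIndepFun_innerLoops_tEns {δ : ℝ} (hδ : 0 ≤ δ) {κ : Type*} (A : κ → Set ℂ)
    (hA : Pairwise fun k l ↦ ∀ p ∈ A k, ∀ q ∈ A l, 2 * δ < dist p q) {β : κ → Type*}
    [∀ k, MeasurableSpace (β k)] (Φ : ∀ k, Set (UnbasedLoop ℂ) → β k)
    (hΦ : ∀ k, Measurable fun ω : tEns.Ω ↦ Φ k {u ∈ (tEns.X δ ω).loops | u.range ⊆ A k}) :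
    iIndepFun (fun k (ω : tEns.Ω) ↦ Φ k {u ∈ (tEns.X δ ω).loops | u.range ⊆ A k}) tEns.P := by
  have hdisj : Pairwise fun k l ↦ Disjoint {s : Site 2 | ∃ p ∈ A k, dist p (triMeshPoint δ s) ≤ δ}
      {s : Site 2 | ∃ p ∈ A l, dist p (triMeshPoint δ s) ≤ δ} := by
    intro k l hkl
    refine Set.disjoint_left.2 fun s ⟨p, hp, hps⟩ ⟨q, hq, hqs⟩ ↦ ?_
    have h := hA hkl p hp q hq
    have := dist_triangle_right p q (triMeshPoint δ s)
    linarith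
  change iIndepFun (fun k (ω : SiteConfig (Site 2)) ↦ Φ k {u ∈ (tEns.X δ ω).loops | u.range ⊆ A k})
    (sitePercolation (Site 2) half)
  refine iIndepFun_of_determined_site half _ hdisj hΦ fun k ω ↦ ?_
  exact congrArg (Φ k) (innerFamily_tEns_inter hδ ω
    {s : Site 2 | ∃ p ∈ A k, dist p (triMeshPoint δ s) ≤ δ} (A k) fun s p hp hps ↦ ⟨p, hp, hps⟩)

/-- Loops inside `A` cut out by a further predicate form a sub-family read off the inner family. -/
theorem sep_subset_and_eq (L : Set (UnbasedLoop ℂ)) (A : Set ℂ) (Q : UnbasedLoop ℂ → Prop) :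
    {u ∈ L | u.range ⊆ A ∧ Q u} = {u ∈ {u ∈ L | u.range ⊆ A} | Q u} := by
  ext u
  simp only [mem_setOf_eq, and_assoc]

end UVExpMoments

/-- **Mutual independence of inner-loop statistics of separated regions, both lattice ensembles**
(registered helper toward [A] `uvExpMoments_latticeEnsembles`, line `positive-cone-weight-doubling`;
the chessboard input of `expMoment_centredSum_le_latticeEnsembles`).  For `E ∈ latticeEnsembles`,
mesh `δ ≥ 0`, any index type and regions `A_k ⊆ ℂ` pairwise more than `2δ` apart, the statistics
`ω ↦ Σ_{u ∈ X_δ(ω), trace u ⊆ A_k, Q_k u} g_k u` (any predicates `Q_k`, any real weights `g_k`;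
loop counts for `g = 1`) are MUTUALLY independent under `E.P`: the loops inside `A_k` are a cylinder
functional of the edges with medial point in `A_k` (bond-`ℤ²`) / of the sites within `δ` of `A_k`
(site-`𝕋`), pairwise disjoint coordinate sets of a product measure. -/
theorem iIndepFun_finsum_innerLoops_latticeEnsembles : ∀ E ∈ latticeEnsembles, ∀ {δ : ℝ}, 0 ≤ δ →
    ∀ (κ : Type) (A : κ → Set ℂ) (Q : κ → UnbasedLoop ℂ → Prop) (g : κ → UnbasedLoop ℂ → ℝ),
    (∀ k l, k ≠ l → ∀ p ∈ A k, ∀ q ∈ A l, 2 * δ < dist p q) →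
    ProbabilityTheory.iIndepFun
      (fun k ω ↦ ∑ᶠ u ∈ {u ∈ (E.X δ ω).loops | u.range ⊆ A k ∧ Q k u}, g k u) E.P := by
  intro E hE δ hδ κ A Q g hA
  have hmeas := fun k ↦
    FirstMoment.measurable_finsum_loops_sep E hE δ (fun u ↦ u.range ⊆ A k ∧ Q k u) (g k)
  simp only [latticeEnsembles, Set.mem_insert_iff, Set.mem_singleton_iff] at hE
  rcases hE with rfl | rfl
  · have hA' : Pairwise fun k l ↦ Disjoint (A k) (A l) := fun k l hkl ↦
      Set.disjoint_left.2 fun p hpk hpl ↦ by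
        have h := hA k l hkl p hpk p hpl
        rw [dist_self] at h
        linarith
    have key := UVExpMoments.iIndepFun_innerLoops_zEns δ A hA'
      (fun k (F : Set (UnbasedLoop ℂ)) ↦ ∑ᶠ u ∈ {u ∈ F | Q k u}, g k u) fun k ↦ by
        simp_rw [← UVExpMoments.sep_subset_and_eq]; exact hmeas k
    simp_rw [← UVExpMoments.sep_subset_and_eq] at key
    exact key
  · have key := UVExpMoments.iIndepFun_innerLoops_tEns hδ A (fun k l hkl ↦ hA k l hkl)
      (fun k (F : Set (UnbasedLoop ℂ)) ↦ ∑ᶠ u ∈ {u ∈ F | Q k u}, g k u) fun k ↦ by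
        simp_rw [← UVExpMoments.sep_subset_and_eq]; exact hmeas k
    simp_rw [← UVExpMoments.sep_subset_and_eq] at key
    exact key

end Summit.CriticalPhenomena.CardyFormulaZ2.Cruxes.NestingRigidity.PositiveConeWeightDoubling

end
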